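import Summits.MatrixMultiplication.OmegaCensus.DicyclicExactTiling
import Summits.MatrixMultiplication.OmegaCensus.C2Quaternion40
import HarnessLib

/-!
# `β(C₂ × Q₄₀) = 96`: the sporadic volume `98` does not occur

ω-census, family (b3).  Framing: lottery ticket; floor = certified bounds/negative ranges.

`C2Quaternion40.lean` left `β(C₂ × Q₄₀) ∈ {96, 98}`, the value `98` being possible only through coset parts
`(1,1 | 3,4 | 3,4)` (up to roles and orientation; total slack `26`, below the counting threshold `|A| ≥ 52`).  This file
excludes it:

* `shape98_of_vertex_bounds` (arithmetic, `decide`): at `|A| = 40` a volume `98` compatible with the eight vertex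
  constraints has parts `(1,1 | 3,4 | 3,4)` up to roles and orientation.
* `no_98_core`: in dicyclic type (`c₀ ≠ 0`) with `3 ∤ |A|`, a TPP triple with parts `(1,1 | 3,t₁ | 3,u₁)` whose vertex
  `111` is EXACT (`t₁u₁ + 3u₁ + 3t₁ = |A|`) does not exist: the three boxes `S₀+T₁+U₁ ⊔ S₁+T₀+U₁ ⊔ S₁+T₁+U₀ = A` are
  `c₀`-periodic (`periodic_of_exact_vertex` with the shifted disjointness of `DicyclicExactTiling.lean`); at an odd
  character the periodic box `s + T₀ + U₁` gives `ψ(s)·T̂₀·Û₁ = 0` with `T̂₀ ≠ 0` (three-term sums never vanish when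
  `3 ∤ |A|`), so `Û₁ = 0` at every odd character and `U₁` is periodic; likewise `T₁`; but then `S₀ + T₁ + U₁` cannot be
  an injective sumset (`not_injOn_of_periodic₂₃`).
* `c2_quaternion_40_law`: **`β(C₂ × Q₄₀) = 96 = 16⌊20/3⌋`** (kernel).  With `c2_quaternion_law_all` (every `m ≥ 13`),
  `c2_quaternion_law` / `c2_quaternion_law_mod_six_one` (small `m`) the value `β(C₂ × Q_{4m})` is now a kernel theorem
  for every `m ≥ 3` except `m = 4` (`β(C₂ × Q₁₆) = 32`, LRAT-checked census datum).
-/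

namespace Summit.MatrixMultiplication.OmegaCensus

open Literature.Combinatorics.Additive Finset

set_option synthInstance.maxHeartbeats 400000 in
set_option synthInstance.maxSize 4096 in
/-- Finite check: volume `98` at `N = 40` under the eight vertex constraints forces parts `(1,1 | 3,4 | 3,4)` up to roles
and orientation (about 5 000 evaluations over the divisor loops; the decidability instance of the long proposition needs
a raised synthesis budget). [folklore] -/
theorem vertex_fc98 :
    ((List.range 98).all fun S' =>
      (List.range (if 98 % (S' + 1) = 0 then 98 / (S' + 1) else 0)).all fun T' =>
      (List.range (if 98 % ((S' + 1) * (T' + 1)) = 0 then 98 / ((S' + 1) * (T' + 1)) + 1 else 0)).all fun u₀ =>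
      (List.range (S' + 2)).all fun s₀ => (List.range (T' + 2)).all fun t₀ =>
        decide (
          (S' + 1 - s₀) * t₀ * u₀ + s₀ * (T' + 1 - t₀) * u₀ + s₀ * t₀ * (98 / ((S' + 1) * (T' + 1)) - u₀) ≤ 40 →
          s₀ * (T' + 1 - t₀) * (98 / ((S' + 1) * (T' + 1)) - u₀) + (S' + 1 - s₀) * t₀ * (98 / ((S' + 1) * (T' + 1)) - u₀) +
            (S' + 1 - s₀) * (T' + 1 - t₀) * u₀ ≤ 40 →
          s₀ * t₀ * u₀ + (S' + 1 - s₀) * (T' + 1 - t₀) * u₀ + (S' + 1 - s₀) * t₀ * (98 / ((S' + 1) * (T' + 1)) - u₀) ≤ 40 →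
          (S' + 1 - s₀) * (T' + 1 - t₀) * (98 / ((S' + 1) * (T' + 1)) - u₀) + s₀ * t₀ * (98 / ((S' + 1) * (T' + 1)) - u₀) +
            s₀ * (T' + 1 - t₀) * u₀ ≤ 40 →
          (S' + 1 - s₀) * (T' + 1 - t₀) * u₀ + s₀ * t₀ * u₀ + s₀ * (T' + 1 - t₀) * (98 / ((S' + 1) * (T' + 1)) - u₀) ≤ 40 →
          s₀ * t₀ * (98 / ((S' + 1) * (T' + 1)) - u₀) + (S' + 1 - s₀) * (T' + 1 - t₀) * (98 / ((S' + 1) * (T' + 1)) - u₀) +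
            (S' + 1 - s₀) * t₀ * u₀ ≤ 40 →
          (S' + 1 - s₀) * t₀ * (98 / ((S' + 1) * (T' + 1)) - u₀) + s₀ * (T' + 1 - t₀) * (98 / ((S' + 1) * (T' + 1)) - u₀) +
            s₀ * t₀ * u₀ ≤ 40 →
          s₀ * (T' + 1 - t₀) * u₀ + (S' + 1 - s₀) * t₀ * u₀ + (S' + 1 - s₀) * (T' + 1 - t₀) * (98 / ((S' + 1) * (T' + 1)) - u₀) ≤ 40 →
          (s₀ = 1 ∧ S' + 1 - s₀ = 1 ∧ (t₀ = 3 ∧ T' + 1 - t₀ = 4 ∨ t₀ = 4 ∧ T' + 1 - t₀ = 3) ∧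
              (u₀ = 3 ∧ 98 / ((S' + 1) * (T' + 1)) - u₀ = 4 ∨ u₀ = 4 ∧ 98 / ((S' + 1) * (T' + 1)) - u₀ = 3)) ∨
          (t₀ = 1 ∧ T' + 1 - t₀ = 1 ∧ (u₀ = 3 ∧ 98 / ((S' + 1) * (T' + 1)) - u₀ = 4 ∨ u₀ = 4 ∧ 98 / ((S' + 1) * (T' + 1)) - u₀ = 3) ∧
              (s₀ = 3 ∧ S' + 1 - s₀ = 4 ∨ s₀ = 4 ∧ S' + 1 - s₀ = 3)) ∨
          (u₀ = 1 ∧ 98 / ((S' + 1) * (T' + 1)) - u₀ = 1 ∧ (s₀ = 3 ∧ S' + 1 - s₀ = 4 ∨ s₀ = 4 ∧ S' + 1 - s₀ = 3) ∧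
              (t₀ = 3 ∧ T' + 1 - t₀ = 4 ∨ t₀ = 4 ∧ T' + 1 - t₀ = 3)))) = true := by
  decide

/-- The arithmetic at `N = 40`: volume `98` forces parts `(1,1 | 3,4 | 3,4)` up to roles and orientation. [folklore] -/
theorem shape98_of_vertex_bounds (s₀ s₁ t₀ t₁ u₀ u₁ : ℕ)
    (h000 : s₁ * t₀ * u₀ + s₀ * t₁ * u₀ + s₀ * t₀ * u₁ ≤ 40) (h111 : s₀ * t₁ * u₁ + s₁ * t₀ * u₁ + s₁ * t₁ * u₀ ≤ 40)
    (h100 : s₀ * t₀ * u₀ + s₁ * t₁ * u₀ + s₁ * t₀ * u₁ ≤ 40) (h011 : s₁ * t₁ * u₁ + s₀ * t₀ * u₁ + s₀ * t₁ * u₀ ≤ 40)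
    (h010 : s₁ * t₁ * u₀ + s₀ * t₀ * u₀ + s₀ * t₁ * u₁ ≤ 40) (h101 : s₀ * t₀ * u₁ + s₁ * t₁ * u₁ + s₁ * t₀ * u₀ ≤ 40)
    (h001 : s₁ * t₀ * u₁ + s₀ * t₁ * u₁ + s₀ * t₀ * u₀ ≤ 40) (h110 : s₀ * t₁ * u₀ + s₁ * t₀ * u₀ + s₁ * t₁ * u₁ ≤ 40)
    (hV : (s₀ + s₁) * (t₀ + t₁) * (u₀ + u₁) = 98) :
    (s₀ = 1 ∧ s₁ = 1 ∧ (t₀ = 3 ∧ t₁ = 4 ∨ t₀ = 4 ∧ t₁ = 3) ∧ (u₀ = 3 ∧ u₁ = 4 ∨ u₀ = 4 ∧ u₁ = 3)) ∨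
    (t₀ = 1 ∧ t₁ = 1 ∧ (u₀ = 3 ∧ u₁ = 4 ∨ u₀ = 4 ∧ u₁ = 3) ∧ (s₀ = 3 ∧ s₁ = 4 ∨ s₀ = 4 ∧ s₁ = 3)) ∨
    (u₀ = 1 ∧ u₁ = 1 ∧ (s₀ = 3 ∧ s₁ = 4 ∨ s₀ = 4 ∧ s₁ = 3) ∧ (t₀ = 3 ∧ t₁ = 4 ∨ t₀ = 4 ∧ t₁ = 3)) := by
  set S := s₀ + s₁ with hS
  set T := t₀ + t₁ with hT
  set U := u₀ + u₁ with hU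
  have hS1 : 1 ≤ S := Nat.pos_of_ne_zero (by rintro h0; rw [h0, zero_mul, zero_mul] at hV; omega)
  have hT1 : 1 ≤ T := Nat.pos_of_ne_zero (by rintro h0; rw [h0, mul_zero, zero_mul] at hV; omega)
  have hU1 : 1 ≤ U := Nat.pos_of_ne_zero (by rintro h0; rw [h0, mul_zero] at hV; omega)
  have hSd : 98 % S = 0 := Nat.mod_eq_zero_of_dvd ⟨T * U, by rw [← hV]; ring⟩
  have hSTd : 98 % (S * T) = 0 := Nat.mod_eq_zero_of_dvd ⟨U, hV.symm⟩
  have hUq : 98 / (S * T) = U := by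
    rw [← hV]; exact Nat.mul_div_cancel_left U (by positivity)
  have hST : S * T ≤ 98 := le_trans (Nat.le_mul_of_pos_right _ hU1) hV.le
  have hSle : S ≤ 98 := le_trans (Nat.le_mul_of_pos_right _ hT1) hST
  have iS : S - 1 < 98 := by omega
  have e1S : S - 1 + 1 = S := Nat.sub_add_cancel hS1
  have e1T : T - 1 + 1 = T := Nat.sub_add_cancel hT1
  have iT : T - 1 < (if 98 % (S - 1 + 1) = 0 then 98 / (S - 1 + 1) else 0) := by
    rw [e1S, if_pos hSd]
    have : T ≤ 98 / S := (Nat.le_div_iff_mul_le hS1).2 (by rw [mul_comm]; exact hST)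
    omega
  have iU : u₀ < (if 98 % ((S - 1 + 1) * (T - 1 + 1)) = 0 then 98 / ((S - 1 + 1) * (T - 1 + 1)) + 1 else 0) := by
    rw [e1S, e1T, if_pos hSTd, hUq]; omega
  have is₀ : s₀ < S - 1 + 2 := by omega
  have it₀ : t₀ < T - 1 + 2 := by omega
  have key := vertex_fc98
  simp only [List.all_eq_true, List.mem_range, decide_eq_true_iff] at key
  have k := key (S - 1) iS (T - 1) iT u₀ iU s₀ is₀ t₀ it₀
  have e1 : S - 1 + 1 - s₀ = s₁ := by omega
  have e2 : T - 1 + 1 - t₀ = t₁ := by omega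
  have e3 : 98 / ((S - 1 + 1) * (T - 1 + 1)) - u₀ = u₁ := by rw [e1S, e1T, hUq]; omega
  simp only [e1, e2, e3] at k
  exact k h000 h111 h100 h011 h010 h101 h001 h110

section DihedralLike

variable {A : Type*} [AddCommGroup A] [DecidableEq A] [Fintype A] {G : Type} [Group G] [DecidableEq G]
  {ρ τ : A → G} {c₀ : A} {S T U : Finset G}

/-- **Core**: dicyclic type, `3 ∤ |A|`; a TPP triple with parts `(1,1 | 3,t₁ | 3,u₁)` whose vertex `111` is exact
(`t₁u₁ + 3u₁ + 3t₁ = |A|`) does not exist. [folklore] -/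
theorem no_98_core
    (hρρ : ∀ a b, ρ a * ρ b = ρ (a + b)) (hρτ : ∀ a b, ρ a * τ b = τ (b - a))
    (hτρ : ∀ a b, τ a * ρ b = τ (a + b)) (hττ : ∀ a b, τ a * τ b = ρ (c₀ + b - a)) (hc₀ : c₀ ≠ 0)
    (hρ : Function.Injective ρ) (hτ : Function.Injective τ) (hne : ∀ a b, ρ a ≠ τ b)
    (h3 : ¬ 3 ∣ Fintype.card A) (h : TripleProductProperty S T U)
    (hs₀ : (univ.filter fun a : A => ρ a ∈ S).card = 1) (hs₁ : (univ.filter fun a : A => τ a ∈ S).card = 1)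
    (ht₀ : (univ.filter fun a : A => ρ a ∈ T).card = 3) (hu₀ : (univ.filter fun a : A => ρ a ∈ U).card = 3)
    (hex : (univ.filter fun a : A => τ a ∈ T).card * (univ.filter fun a : A => τ a ∈ U).card +
      3 * (univ.filter fun a : A => τ a ∈ U).card + 3 * (univ.filter fun a : A => τ a ∈ T).card = Fintype.card A) :
    False := by
  set S₀ : Finset A := univ.filter fun a => ρ a ∈ S with hS₀
  set S₁ : Finset A := univ.filter fun a => τ a ∈ S with hS₁
  set T₀ : Finset A := univ.filter fun a => ρ a ∈ T with hT₀
  set T₁ : Finset A := univ.filter fun a => τ a ∈ T with hT₁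
  set U₀ : Finset A := univ.filter fun a => ρ a ∈ U with hU₀
  set U₁ : Finset A := univ.filter fun a => τ a ∈ U with hU₁
  have h2c := two_c0_eq_zero hρτ hτρ hττ hτ
  have mS₀ : ∀ a ∈ S₀, cond false (τ a) (ρ a) ∈ S := fun a ha => by simpa [hS₀] using ha
  have mS₁ : ∀ a ∈ S₁, cond true (τ a) (ρ a) ∈ S := fun a ha => by simpa [hS₁] using ha
  have mT₀ : ∀ a ∈ T₀, cond false (τ a) (ρ a) ∈ T := fun a ha => by simpa [hT₀] using ha
  have mT₁ : ∀ a ∈ T₁, cond true (τ a) (ρ a) ∈ T := fun a ha => by simpa [hT₁] using ha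
  have mU₀ : ∀ a ∈ U₀, cond false (τ a) (ρ a) ∈ U := fun a ha => by simpa [hU₀] using ha
  have mU₁ : ∀ a ∈ U₁, cond true (τ a) (ρ a) ∈ U := fun a ha => by simpa [hU₁] using ha
  have cs := card_sumset' hρρ hττ hρ hτ h
  have inj := sum_injOn' hρρ hττ hρ hτ h
  -- the exact vertex `111`: boxes `B011 = S₀+T₁+U₁`, `B101 = S₁+T₀+U₁`, `B110 = S₁+T₁+U₀`
  set B011 := (S₀ ×ˢ T₁ ×ˢ U₁).image fun p : A × A × A => p.1 + p.2.1 + p.2.2 with hB011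
  set B101 := (S₁ ×ˢ T₀ ×ˢ U₁).image fun p : A × A × A => p.1 + p.2.1 + p.2.2 with hB101
  set B110 := (S₁ ×ˢ T₁ ×ˢ U₀).image fun p : A × A × A => p.1 + p.2.1 + p.2.2 with hB110
  have d₁ : Disjoint B101 B011 := (disjoint_sumset₁' hρρ hρτ hτρ hττ hne h) true mS₁ mT₀ mU₁ mS₀ mT₁
  have d₂ : Disjoint B110 B101 := (disjoint_sumset₂' hρρ hρτ hτρ hττ hne h) true mS₁ mT₁ mU₀ mS₁ mT₀ mU₁
  have d₃ : Disjoint B011 B110 := (disjoint_sumset₃' hρρ hρτ hτρ hττ hne h) true mS₀ mT₁ mU₁ mS₁ mU₀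
  have sh₁ : Disjoint B101 (B011.image (· + c₀)) :=
    (disjoint_sumset₁_shift' hρρ hρτ hττ hne h) true mS₁ mT₀ mU₁ mS₀ mT₁
  have sh₂ : Disjoint (B101.image (· + c₀)) B110 :=
    (disjoint_sumset₂_shift' hρρ hρτ hττ hne h) true mS₁ mT₀ mU₁ mS₁ mT₁ mU₀
  have sh₃ : Disjoint B110 (B011.image (· + c₀)) :=
    (disjoint_sumset₃_shift' hρρ hρτ hτρ hττ hne h) true mS₁ mT₁ mU₀ mS₀ mU₁
  have c011 : B011.card = 1 * T₁.card * U₁.card := by rw [hB011, cs false true true mS₀ mT₁ mU₁, hs₀]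
  have c101 : B101.card = 1 * 3 * U₁.card := by rw [hB101, cs true false true mS₁ mT₀ mU₁, hs₁, ht₀]
  have c110 : B110.card = 1 * T₁.card * 3 := by rw [hB110, cs true true false mS₁ mT₁ mU₀, hs₁, hu₀]
  have hper101 : B101.image (· + c₀) = B101 :=
    periodic_of_exact_vertex d₁ d₂.symm d₃ (by rw [c011, c101, c110, ← hex]; ring)
      (disjoint_image_add_comm h2c sh₁) sh₂
  have hper110 : B110.image (· + c₀) = B110 :=
    periodic_of_exact_vertex d₃.symm d₂ d₁.symm (by rw [c011, c101, c110, ← hex]; ring)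
      (disjoint_image_add_comm h2c sh₃) (disjoint_image_add_comm h2c sh₂.symm)
  -- the singletons / triples
  obtain ⟨s, hS₁s⟩ := card_eq_one.1 hs₁
  obtain ⟨x₁, x₂, x₃, h12, h13, h23, hT₀eq⟩ := card_eq_three.1 ht₀
  obtain ⟨y₁, y₂, y₃, k12, k13, k23, hU₀eq⟩ := card_eq_three.1 hu₀
  have sumS₁ : ∀ ψ : AddChar A ℂ, ∑ a ∈ S₁, ψ a = ψ s := fun ψ => by rw [hS₁s, sum_singleton]
  have sumT₀ : ∀ ψ : AddChar A ℂ, ∑ a ∈ T₀, ψ a ≠ 0 := fun ψ => by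
    rw [hT₀eq, sum_insert (by simp [h12, h13]), sum_insert (by simp [h23]), sum_singleton, ← add_assoc]
    exact three_term_charsum_ne_zero h3 ψ _ _ _
  have sumU₀ : ∀ ψ : AddChar A ℂ, ∑ a ∈ U₀, ψ a ≠ 0 := fun ψ => by
    rw [hU₀eq, sum_insert (by simp [k12, k13]), sum_insert (by simp [k23]), sum_singleton, ← add_assoc]
    exact three_term_charsum_ne_zero h3 ψ _ _ _
  -- `U₁` and `T₁` are periodic
  have hU₁per : U₁.image (fun x => x + c₀) = U₁ := by
    refine periodic_of_charsum_eq_zero h2c fun ψ hψ => ?_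
    have z := charsum_eq_zero_of_periodic hper101 hψ
    rw [hB101, charsum_sumset' ψ (inj true false true mS₁ mT₀ mU₁), sumS₁] at z
    exact zero_of_mul₃ z (addChar_ne_zero ψ s) (sumT₀ ψ)
  have hT₁per : T₁.image (fun x => x + c₀) = T₁ := by
    refine periodic_of_charsum_eq_zero h2c fun ψ hψ => ?_
    have z := charsum_eq_zero_of_periodic hper110 hψ
    rw [hB110, charsum_sumset' ψ (inj true true false mS₁ mT₁ mU₀), sumS₁] at z
    exact zero_of_mul₂ z (addChar_ne_zero ψ s) (sumU₀ ψ)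
  -- but then `S₀ + T₁ + U₁` is not injective
  have hS₀ne : S₀.Nonempty := card_pos.1 (by rw [hs₀]; norm_num)
  have hT₁ne : T₁.Nonempty := card_pos.1 (Nat.pos_of_ne_zero fun h0 => h3 ⟨U₁.card, by rw [h0] at hex; omega⟩)
  have hU₁ne : U₁.Nonempty := card_pos.1 (Nat.pos_of_ne_zero fun h0 => h3 ⟨T₁.card, by rw [h0] at hex; omega⟩)
  exact not_injOn_of_periodic₂₃ hc₀ hT₁per hU₁per hS₀ne hT₁ne hU₁ne (inj false true true mS₀ mT₁ mU₁)

/-- **Volume `98` at `|A| = 40` is impossible in dicyclic type**: all twelve part patterns of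
`shape98_of_vertex_bounds` are reduced to the core by role rotations and `τ0`-translations. [folklore] -/
theorem no_98_of_c0_ne_zero
    (hρρ : ∀ a b, ρ a * ρ b = ρ (a + b)) (hρτ : ∀ a b, ρ a * τ b = τ (b - a))
    (hτρ : ∀ a b, τ a * ρ b = τ (a + b)) (hττ : ∀ a b, τ a * τ b = ρ (c₀ + b - a)) (hc₀ : c₀ ≠ 0)
    (hρ : Function.Injective ρ) (hτ : Function.Injective τ) (hne : ∀ a b, ρ a ≠ τ b)
    (hA : Fintype.card A = 40) (h : TripleProductProperty S T U)
    (hsh :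
      ((univ.filter fun a : A => ρ a ∈ S).card = 1 ∧ (univ.filter fun a : A => τ a ∈ S).card = 1 ∧
        ((univ.filter fun a : A => ρ a ∈ T).card = 3 ∧ (univ.filter fun a : A => τ a ∈ T).card = 4 ∨
          (univ.filter fun a : A => ρ a ∈ T).card = 4 ∧ (univ.filter fun a : A => τ a ∈ T).card = 3) ∧
        ((univ.filter fun a : A => ρ a ∈ U).card = 3 ∧ (univ.filter fun a : A => τ a ∈ U).card = 4 ∨
          (univ.filter fun a : A => ρ a ∈ U).card = 4 ∧ (univ.filter fun a : A => τ a ∈ U).card = 3)) ∨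
      ((univ.filter fun a : A => ρ a ∈ T).card = 1 ∧ (univ.filter fun a : A => τ a ∈ T).card = 1 ∧
        ((univ.filter fun a : A => ρ a ∈ U).card = 3 ∧ (univ.filter fun a : A => τ a ∈ U).card = 4 ∨
          (univ.filter fun a : A => ρ a ∈ U).card = 4 ∧ (univ.filter fun a : A => τ a ∈ U).card = 3) ∧
        ((univ.filter fun a : A => ρ a ∈ S).card = 3 ∧ (univ.filter fun a : A => τ a ∈ S).card = 4 ∨
          (univ.filter fun a : A => ρ a ∈ S).card = 4 ∧ (univ.filter fun a : A => τ a ∈ S).card = 3)) ∨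
      ((univ.filter fun a : A => ρ a ∈ U).card = 1 ∧ (univ.filter fun a : A => τ a ∈ U).card = 1 ∧
        ((univ.filter fun a : A => ρ a ∈ S).card = 3 ∧ (univ.filter fun a : A => τ a ∈ S).card = 4 ∨
          (univ.filter fun a : A => ρ a ∈ S).card = 4 ∧ (univ.filter fun a : A => τ a ∈ S).card = 3) ∧
        ((univ.filter fun a : A => ρ a ∈ T).card = 3 ∧ (univ.filter fun a : A => τ a ∈ T).card = 4 ∨
          (univ.filter fun a : A => ρ a ∈ T).card = 4 ∧ (univ.filter fun a : A => τ a ∈ T).card = 3))) :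
    False := by
  have h3 : ¬ 3 ∣ Fintype.card A := by rw [hA]; norm_num
  have er : (Equiv.mulRight (1 : G)).toEmbedding = Function.Embedding.refl G := by ext x; simp
  -- the oriented statement for an arbitrary TPP triple `(X, Y, Z)` of `G`
  have oriented : ∀ {X Y Z : Finset G}, TripleProductProperty X Y Z →
      (univ.filter fun a : A => ρ a ∈ X).card = 1 → (univ.filter fun a : A => τ a ∈ X).card = 1 →
      ((univ.filter fun a : A => ρ a ∈ Y).card = 3 ∧ (univ.filter fun a : A => τ a ∈ Y).card = 4 ∨
        (univ.filter fun a : A => ρ a ∈ Y).card = 4 ∧ (univ.filter fun a : A => τ a ∈ Y).card = 3) →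
      ((univ.filter fun a : A => ρ a ∈ Z).card = 3 ∧ (univ.filter fun a : A => τ a ∈ Z).card = 4 ∨
        (univ.filter fun a : A => ρ a ∈ Z).card = 4 ∧ (univ.filter fun a : A => τ a ∈ Z).card = 3) → False := by
    intro X Y Z hX hx₀ hx₁ hY hZ
    have cρY := card_rho_part_mulRight_tau hρρ hρτ hττ (A := A) Y
    have cτY := card_tau_part_mulRight_tau hρρ hττ (A := A) Y
    have cρZ := card_rho_part_mulRight_tau hρρ hρτ hττ (A := A) Z
    have cτZ := card_tau_part_mulRight_tau hρρ hττ (A := A) Z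
    rcases hY with ⟨hy₀, hy₁⟩ | ⟨hy₀, hy₁⟩ <;> rcases hZ with ⟨hz₀, hz₁⟩ | ⟨hz₀, hz₁⟩
    · exact no_98_core hρρ hρτ hτρ hττ hc₀ hρ hτ hne h3 hX hx₀ hx₁ hy₀ hz₀ (by rw [hy₁, hz₁, hA])
    · have h' := hX.map_mulRight 1 1 (τ 0)
      simp only [er, Finset.map_refl] at h'
      exact no_98_core hρρ hρτ hτρ hττ hc₀ hρ hτ hne h3 h' hx₀ hx₁ hy₀ (by rw [cρZ, hz₁])
        (by rw [hy₁, cτZ, hz₀, hA])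
    · have h' := hX.map_mulRight 1 (τ 0) 1
      simp only [er, Finset.map_refl] at h'
      exact no_98_core hρρ hρτ hτρ hττ hc₀ hρ hτ hne h3 h' hx₀ hx₁ (by rw [cρY, hy₁]) hz₀
        (by rw [cτY, hy₀, hz₁, hA])
    · have h' := hX.map_mulRight 1 (τ 0) (τ 0)
      simp only [er, Finset.map_refl] at h'
      exact no_98_core hρρ hρτ hτρ hττ hc₀ hρ hτ hne h3 h' hx₀ hx₁ (by rw [cρY, hy₁]) (by rw [cρZ, hz₁])
        (by rw [cτY, hy₀, cτZ, hz₀, hA])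
  rcases hsh with ⟨hs₀, hs₁, hT, hU⟩ | ⟨ht₀, ht₁, hU, hS⟩ | ⟨hu₀, hu₁, hS, hT⟩
  · exact oriented h hs₀ hs₁ hT hU
  · exact oriented h.rotate ht₀ ht₁ hU hS
  · exact oriented h.rotate.rotate hu₀ hu₁ hS hT

end DihedralLike

section C2Q40

/-- **`β(C₂ × Q₄₀) = 96`** (kernel): every TPP triple of `C₂ × Q₄₀ = Multiplicative (ZMod 2) × QuaternionGroup 10`
has `|S||T||U| ≤ 96`, and `96` is attained. [folklore] -/
theorem c2_quaternion_40_law :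
    (∀ S T U : Finset (Multiplicative (ZMod 2) × QuaternionGroup 10), TripleProductProperty S T U →
        S.card * T.card * U.card ≤ 96) ∧
    ∃ S T U : Finset (Multiplicative (ZMod 2) × QuaternionGroup 10), TripleProductProperty S T U ∧
      S.card * T.card * U.card = 96 := by
  refine ⟨fun S T U h => ?_, c2_quaternion_40.2⟩
  rcases c2_quaternion_40.1 S T U h with h96 | h98
  · exact h96
  · exfalso
    obtain ⟨hc₀, -⟩ := z2_z2m_quot_half_noncyclic (m := 10) ⟨5, rfl⟩
    refine c2_quaternion_presentation (m := 10) fun ρ τ c₀ hρρ hρτ hτρ hττ hρ hτ hne' hsurj hc => ?_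
    subst hc
    have hcard : Fintype.card (ZMod 2 × ZMod (2 * 10)) = 40 := by rw [Fintype.card_prod, ZMod.card, ZMod.card]
    obtain ⟨h000, h111, h100, h011, h010, h101, h001, h110⟩ := vertex_counting' hρρ hρτ hτρ hττ hρ hτ hne' h
    rw [hcard] at h000 h111 h100 h011 h010 h101 h001 h110
    have cS := card_eq_parts' hρ hτ hne' hsurj S
    have cT := card_eq_parts' hρ hτ hne' hsurj T
    have cU := card_eq_parts' hρ hτ hne' hsurj U
    rw [cS, cT, cU] at h98
    have hsh := shape98_of_vertex_bounds _ _ _ _ _ _ h000 h111 h100 h011 h010 h101 h001 h110 h98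
    exact no_98_of_c0_ne_zero hρρ hρτ hτρ hττ hc₀ hρ hτ hne' hcard h hsh

end C2Q40

end Summit.MatrixMultiplication.OmegaCensus
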